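import Literature.AlgebraicGeometry.Frobenioids.ArchimedeanPerfectionRationalFunctionMonoid
import Literature.AlgebraicGeometry.Frobenioids.ArchimedeanPerfectionRationalFunctionMonoidE
import Literature.AlgebraicGeometry.Frobenioids.Thm36SubPfModelPrep
import HarnessLib

/-!
# Frobenioids II, Thm. 3.6 (i) at `Λ = ℚ`: "model type, with rational function monoid ≅ `(Φ^fld)^ℚ`" for THE
# perfection `C^ℚ = C^pf` — the `RationalFunctionMonoidStr` term and the closer, MODULO the radial section and
# the two germ-transport laws (FILE B-arch, part 2b; proof-only)

Mochizuki, *The geometry of Frobenioids II: poly-Frobenioids*, Kyushu J. Math. **62** (2008) 401–460, §3,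
Theorem 3.6 (i), kurims text p. 36 ll. 34–35 [cite: MochizukiFrdII2008, Thm 3.6 (i) p.36]; [FrdI] Prop. 4.4
(ii)/(iii) p. 83 and Thm. 5.2 (iv) p. 101 [cite: MochizukiFrdI2008, Thm. 5.2(iv) p.101].

abc-iut cell, layer L1, row M13-c3 «FILE B-arch» (HOME/staging/L1/L1-t6/g3/M13-c3-DESIGN.md; seat abc-iut-L1-t6).
From a FAMILY of radial sections `σ_X` of the divisor maps of the objects `X` of `C^pf` (piece (S), seats
abc-iut-w5-d246 / w5-d194: positive-real-scalar germs) satisfying the two TRANSPORT LAWS along linear arrows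
(pieces (T-rad), (T-unit)), this file assembles
* `Thm36Sub.rationalFunctionMonoidStr_Q_of_section` — [FrdI] Thm. 5.2 (iv)'s hypothesis structure
  `RationalFunctionMonoidStr (C^pf → F_{Φ^pf}) hPf ((Φ^fld)^pf) (Div_Q)` at the PRINTED datum
  `(Φ^fld)^ℚ := (Φ^fld)^pf = perfectionFunctor (fieldMonoid (Φ π) π)`, `Div_Q = divPerfection (fieldMonoidToGp (Φ π) π)`
  (fields: `iso := isoOfSection`, `div_iso := divHom_isoOfSection_eq_divPerfection`, `natural := intertwines_isoOfSection`,
  all from `ArchimedeanPerfectionRationalFunctionMonoid.lean`), inside a proof (no data `def`), and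
* **`Thm36Sub.istrModel_Q_of_section`** — abc-iut-L1-t9's typed sentence
  `Thm36i_istrModel (pfStr π hF) (ModelFrobenioid.toElem Φ^pf (Φ^fld)^pf Div_Q)` ("`(C^ℚ)^istr` is of model
  type, with rational function monoid naturally isomorphic to `(Φ^fld)^ℚ`") from (S), (T-rad), (T-unit), by
  `istrModel_Q_of_str` (`Thm36SubPfModelPrep.lean`: [FrdI] Thm. 5.2 (iv) + isotropic + model type).
The unconditional closer `istrModel_Q_holds` is this theorem applied to the landed (S)/(T) facts.  Proof-only, no
definitions; [FrdII] §3 is classical; nothing here bears on [IUTchIII] Cor. 3.12.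

**v2 (unit coordinate).**  The `hunit` binder of the two theorems above is stated for the unit coordinate
`unitsPerfEquiv X` of part 2a, which is NOT natural in `X = (A, n)`: along a linear `ψ = [ψ₀ : A^{(a)} → A′^{(b)}]`
with `X.idx ≠ X′.idx` the square `θ ≫ ψ₀ = ψ₀ ≫ θ′` forces the value of the transported unit to be multiplied by
`b/a = X.idx/X′.idx` (finding F-w5d246-1 of seat abc-iut-w5-d246, confirmed by abc-iut-L1-t6), so that binder can
only be met between objects of equal index and the two theorems, while true, are not the route to Thm. 3.6 (i).
The theorems `…_of_sectionE` below take an ARBITRARY family of unit coordinates `e X : (O_K^×)^pf ≃* O^×(X)`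
(`isoOfSectionE` of `ArchimedeanPerfectionRationalFunctionMonoidE.lean`), and `…_of_sectionNat` specialise them to
the NATURAL coordinate `unitsPerfEquivNat X = (unitsPerfEquiv X ∘ ι_X^*) ^ X.idx` (structure twist and index built
in), whose `hunit` binder is the transport law of unit germs that actually holds (piece (T-unit)).
-/

noncomputable section

namespace Literature.AlgebraicGeometry.Frobenioids

open CategoryTheory Opposite

namespace ArchFrd

namespace Thm36Sub

universe v u

variable {D : Type u} [Category.{v} D] (π : D ⥤ D0) (hF : PreFrobenioid.IsFrobenioid (C.toElem π))

open PreFrobenioid PreFrobenioid.Perfection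

/-- **[FrdI] Thm. 5.2 (iv)'s structure at the printed `Λ = ℚ` datum, from a radial section and the transport
laws**: `Nonempty (RationalFunctionMonoidStr (C^pf → F_{Φ^pf}) hPf ((Φ^fld)^pf) Div_Q)`.
[cite: MochizukiFrdI2008, Prop. 4.4(ii) p.83] -/
theorem rationalFunctionMonoidStr_Q_of_section
    (σ : ∀ X : pfCat π hF, PhiGp (pfStr π hF) X →* BiratUnits (pfStr π hF) (pf_isFrobenioid π hF) X)
    (hσ : ∀ (X : pfCat π hF) (x : PhiGp (pfStr π hF) X), BiratUnits.divHom (pf_isFrobenioid π hF) X (σ X x) = x)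
    (hrad : ∀ ⦃X X' : pfCat π hF⦄ (ψ : X ⟶ X'), IsLinear (pfStr π hF) ψ →
      ∀ z : Algebra.GrothendieckGroup ((Φ π).obj (op X'.obj.snd)),
        BiratUnits.Intertwines (pf_isFrobenioid π hF) ψ
          (σ X (gpMap (Perfection.of ((Φ π).obj (op X.obj.snd)))
            (gpMap ((Φ π).map (Base (pfStr π hF) ψ).op).hom z)))
          (σ X' (gpMap (Perfection.of ((Φ π).obj (op X'.obj.snd))) z)))
    (hunit : ∀ ⦃X X' : pfCat π hF⦄ (ψ : X ⟶ X'), IsLinear (pfStr π hF) ψ →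
      ∀ w : D0.unitScalars (π.obj X'.obj.snd),
        BiratUnits.Intertwines (pf_isFrobenioid π hF) ψ
          (BiratUnits.unitsToBirat (pf_isFrobenioid π hF) X
            (unitsPerfEquiv X (Perfection.of _ (D0.unitPull (π.map (Base (pfStr π hF) ψ)) w))))
          (BiratUnits.unitsToBirat (pf_isFrobenioid π hF) X' (unitsPerfEquiv X' (Perfection.of _ w)))) :
    Nonempty (RationalFunctionMonoidStr (pfStr π hF) (pf_isFrobenioid π hF)
      (perfectionFunctor (fieldMonoid (Φ π) π)) (divPerfection (fieldMonoidToGp (Φ π) π))) :=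
  ⟨{ iso := fun X => isoOfSection X (σ X) (hσ X)
     div_iso := fun X b => divHom_isoOfSection_eq_divPerfection X (σ X) (hσ X) b
     natural := fun X X' ψ hψ b' =>
       intertwines_isoOfSection ψ hψ (σ X) (hσ X) (σ X') (hσ X') (hrad ψ hψ) (hunit ψ hψ) b' }⟩

/-- **[FrdII] Thm. 3.6 (i), "model type, with rational function monoid ≅ `(Φ^fld)^ℚ`", for `C^ℚ = C^pf` — from
the radial sections (S) and the germ-transport laws (T-rad), (T-unit)**: `(C^pf)^istr ≌` the model Frobenioid of
`(Φ^pf, (Φ^fld)^pf, Div_Q)` compatibly with the structure functors (abc-iut-L1-t9's `Thm36i_istrModel`).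
[cite: MochizukiFrdII2008, Thm 3.6 (i) p.36] -/
theorem istrModel_Q_of_section
    (σ : ∀ X : pfCat π hF, PhiGp (pfStr π hF) X →* BiratUnits (pfStr π hF) (pf_isFrobenioid π hF) X)
    (hσ : ∀ (X : pfCat π hF) (x : PhiGp (pfStr π hF) X), BiratUnits.divHom (pf_isFrobenioid π hF) X (σ X x) = x)
    (hrad : ∀ ⦃X X' : pfCat π hF⦄ (ψ : X ⟶ X'), IsLinear (pfStr π hF) ψ →
      ∀ z : Algebra.GrothendieckGroup ((Φ π).obj (op X'.obj.snd)),
        BiratUnits.Intertwines (pf_isFrobenioid π hF) ψ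
          (σ X (gpMap (Perfection.of ((Φ π).obj (op X.obj.snd)))
            (gpMap ((Φ π).map (Base (pfStr π hF) ψ).op).hom z)))
          (σ X' (gpMap (Perfection.of ((Φ π).obj (op X'.obj.snd))) z)))
    (hunit : ∀ ⦃X X' : pfCat π hF⦄ (ψ : X ⟶ X'), IsLinear (pfStr π hF) ψ →
      ∀ w : D0.unitScalars (π.obj X'.obj.snd),
        BiratUnits.Intertwines (pf_isFrobenioid π hF) ψ
          (BiratUnits.unitsToBirat (pf_isFrobenioid π hF) X
            (unitsPerfEquiv X (Perfection.of _ (D0.unitPull (π.map (Base (pfStr π hF) ψ)) w))))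
          (BiratUnits.unitsToBirat (pf_isFrobenioid π hF) X' (unitsPerfEquiv X' (Perfection.of _ w)))) :
    Thm36i_istrModel (pfStr π hF)
      (ModelFrobenioid.toElem (PreFrobenioid.Perfection.ops hF).monFunctor
        (perfectionFunctor (fieldMonoid (Φ π) π)) (divPerfection (fieldMonoidToGp (Φ π) π))) := by
  obtain ⟨R⟩ := rationalFunctionMonoidStr_Q_of_section π hF σ hσ hrad hunit
  exact istrModel_Q_of_str π hF R

/-! ### v2: arbitrary unit coordinates, and the natural one -/

/-- **[FrdI] Thm. 5.2 (iv)'s structure at the printed `Λ = ℚ` datum, from unit coordinates `e`, radial sections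
`σ` and the two transport laws** (the unit law stated for `e`). [cite: MochizukiFrdI2008, Prop. 4.4(ii) p.83] -/
theorem rationalFunctionMonoidStr_Q_of_sectionE
    (e : ∀ X : pfCat π hF, Perfection (D0.unitScalars (π.obj X.obj.snd)) ≃* unitsSubgroup (pfStr π hF) X)
    (σ : ∀ X : pfCat π hF, PhiGp (pfStr π hF) X →* BiratUnits (pfStr π hF) (pf_isFrobenioid π hF) X)
    (hσ : ∀ (X : pfCat π hF) (x : PhiGp (pfStr π hF) X), BiratUnits.divHom (pf_isFrobenioid π hF) X (σ X x) = x)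
    (hrad : ∀ ⦃X X' : pfCat π hF⦄ (ψ : X ⟶ X'), IsLinear (pfStr π hF) ψ →
      ∀ z : Algebra.GrothendieckGroup ((Φ π).obj (op X'.obj.snd)),
        BiratUnits.Intertwines (pf_isFrobenioid π hF) ψ
          (σ X (gpMap (Perfection.of ((Φ π).obj (op X.obj.snd)))
            (gpMap ((Φ π).map (Base (pfStr π hF) ψ).op).hom z)))
          (σ X' (gpMap (Perfection.of ((Φ π).obj (op X'.obj.snd))) z)))
    (hunit : ∀ ⦃X X' : pfCat π hF⦄ (ψ : X ⟶ X'), IsLinear (pfStr π hF) ψ →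
      ∀ w : D0.unitScalars (π.obj X'.obj.snd),
        BiratUnits.Intertwines (pf_isFrobenioid π hF) ψ
          (BiratUnits.unitsToBirat (pf_isFrobenioid π hF) X
            (e X (Perfection.of _ (D0.unitPull (π.map (Base (pfStr π hF) ψ)) w))))
          (BiratUnits.unitsToBirat (pf_isFrobenioid π hF) X' (e X' (Perfection.of _ w)))) :
    Nonempty (RationalFunctionMonoidStr (pfStr π hF) (pf_isFrobenioid π hF)
      (perfectionFunctor (fieldMonoid (Φ π) π)) (divPerfection (fieldMonoidToGp (Φ π) π))) :=
  ⟨{ iso := fun X => isoOfSectionE X (e X) (σ X) (hσ X)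
     div_iso := fun X b => divHom_isoOfSectionE_eq_divPerfection X (e X) (σ X) (hσ X) b
     natural := fun X X' ψ hψ b' =>
       intertwines_isoOfSectionE ψ hψ (e X) (e X') (σ X) (hσ X) (σ X') (hσ X') (hrad ψ hψ) (hunit ψ hψ) b' }⟩

/-- **[FrdII] Thm. 3.6 (i), "model type, with rational function monoid ≅ `(Φ^fld)^ℚ`", for `C^ℚ = C^pf`, from
unit coordinates `e`, radial sections (S) and the transport laws (T-rad), (T-unit) (the latter stated for `e`)**.
[cite: MochizukiFrdII2008, Thm 3.6 (i) p.36] -/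
theorem istrModel_Q_of_sectionE
    (e : ∀ X : pfCat π hF, Perfection (D0.unitScalars (π.obj X.obj.snd)) ≃* unitsSubgroup (pfStr π hF) X)
    (σ : ∀ X : pfCat π hF, PhiGp (pfStr π hF) X →* BiratUnits (pfStr π hF) (pf_isFrobenioid π hF) X)
    (hσ : ∀ (X : pfCat π hF) (x : PhiGp (pfStr π hF) X), BiratUnits.divHom (pf_isFrobenioid π hF) X (σ X x) = x)
    (hrad : ∀ ⦃X X' : pfCat π hF⦄ (ψ : X ⟶ X'), IsLinear (pfStr π hF) ψ →
      ∀ z : Algebra.GrothendieckGroup ((Φ π).obj (op X'.obj.snd)),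
        BiratUnits.Intertwines (pf_isFrobenioid π hF) ψ
          (σ X (gpMap (Perfection.of ((Φ π).obj (op X.obj.snd)))
            (gpMap ((Φ π).map (Base (pfStr π hF) ψ).op).hom z)))
          (σ X' (gpMap (Perfection.of ((Φ π).obj (op X'.obj.snd))) z)))
    (hunit : ∀ ⦃X X' : pfCat π hF⦄ (ψ : X ⟶ X'), IsLinear (pfStr π hF) ψ →
      ∀ w : D0.unitScalars (π.obj X'.obj.snd),
        BiratUnits.Intertwines (pf_isFrobenioid π hF) ψ
          (BiratUnits.unitsToBirat (pf_isFrobenioid π hF) X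
            (e X (Perfection.of _ (D0.unitPull (π.map (Base (pfStr π hF) ψ)) w))))
          (BiratUnits.unitsToBirat (pf_isFrobenioid π hF) X' (e X' (Perfection.of _ w)))) :
    Thm36i_istrModel (pfStr π hF)
      (ModelFrobenioid.toElem (PreFrobenioid.Perfection.ops hF).monFunctor
        (perfectionFunctor (fieldMonoid (Φ π) π)) (divPerfection (fieldMonoidToGp (Φ π) π))) := by
  obtain ⟨R⟩ := rationalFunctionMonoidStr_Q_of_sectionE π hF e σ hσ hrad hunit
  exact istrModel_Q_of_str π hF R

/-- **The structure at the NATURAL unit coordinate** `unitsPerfEquivNat` (structure twist and index built in):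
[FrdI] Thm. 5.2 (iv)'s `RationalFunctionMonoidStr` at `B = (Φ^fld)^pf` from radial sections (S) and the
transport laws (T-rad), (T-unit) as they actually hold in `C^pf`. [cite: MochizukiFrdI2008, Prop. 4.4(ii) p.83] -/
theorem rationalFunctionMonoidStr_Q_of_sectionNat
    (σ : ∀ X : pfCat π hF, PhiGp (pfStr π hF) X →* BiratUnits (pfStr π hF) (pf_isFrobenioid π hF) X)
    (hσ : ∀ (X : pfCat π hF) (x : PhiGp (pfStr π hF) X), BiratUnits.divHom (pf_isFrobenioid π hF) X (σ X x) = x)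
    (hrad : ∀ ⦃X X' : pfCat π hF⦄ (ψ : X ⟶ X'), IsLinear (pfStr π hF) ψ →
      ∀ z : Algebra.GrothendieckGroup ((Φ π).obj (op X'.obj.snd)),
        BiratUnits.Intertwines (pf_isFrobenioid π hF) ψ
          (σ X (gpMap (Perfection.of ((Φ π).obj (op X.obj.snd)))
            (gpMap ((Φ π).map (Base (pfStr π hF) ψ).op).hom z)))
          (σ X' (gpMap (Perfection.of ((Φ π).obj (op X'.obj.snd))) z)))
    (hunit : ∀ ⦃X X' : pfCat π hF⦄ (ψ : X ⟶ X'), IsLinear (pfStr π hF) ψ →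
      ∀ w : D0.unitScalars (π.obj X'.obj.snd),
        BiratUnits.Intertwines (pf_isFrobenioid π hF) ψ
          (BiratUnits.unitsToBirat (pf_isFrobenioid π hF) X
            (unitsPerfEquivNat X (Perfection.of _ (D0.unitPull (π.map (Base (pfStr π hF) ψ)) w))))
          (BiratUnits.unitsToBirat (pf_isFrobenioid π hF) X' (unitsPerfEquivNat X' (Perfection.of _ w)))) :
    Nonempty (RationalFunctionMonoidStr (pfStr π hF) (pf_isFrobenioid π hF)
      (perfectionFunctor (fieldMonoid (Φ π) π)) (divPerfection (fieldMonoidToGp (Φ π) π))) :=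
  rationalFunctionMonoidStr_Q_of_sectionE π hF (fun X => unitsPerfEquivNat X) σ hσ hrad hunit

/-- **[FrdII] Thm. 3.6 (i) for `C^ℚ = C^pf` from (S), (T-rad) and the NATURAL unit transport law (T-unit)**:
`Thm36i_istrModel` at the printed datum `((Φ^fld)^pf, Div_Q)`; the unconditional closer `istrModel_Q_holds`
is this theorem at abc-iut-w5-d246's radial sections and the two landed transport theorems.
[cite: MochizukiFrdII2008, Thm 3.6 (i) p.36] -/
theorem istrModel_Q_of_sectionNat
    (σ : ∀ X : pfCat π hF, PhiGp (pfStr π hF) X →* BiratUnits (pfStr π hF) (pf_isFrobenioid π hF) X)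
    (hσ : ∀ (X : pfCat π hF) (x : PhiGp (pfStr π hF) X), BiratUnits.divHom (pf_isFrobenioid π hF) X (σ X x) = x)
    (hrad : ∀ ⦃X X' : pfCat π hF⦄ (ψ : X ⟶ X'), IsLinear (pfStr π hF) ψ →
      ∀ z : Algebra.GrothendieckGroup ((Φ π).obj (op X'.obj.snd)),
        BiratUnits.Intertwines (pf_isFrobenioid π hF) ψ
          (σ X (gpMap (Perfection.of ((Φ π).obj (op X.obj.snd)))
            (gpMap ((Φ π).map (Base (pfStr π hF) ψ).op).hom z)))
          (σ X' (gpMap (Perfection.of ((Φ π).obj (op X'.obj.snd))) z)))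
    (hunit : ∀ ⦃X X' : pfCat π hF⦄ (ψ : X ⟶ X'), IsLinear (pfStr π hF) ψ →
      ∀ w : D0.unitScalars (π.obj X'.obj.snd),
        BiratUnits.Intertwines (pf_isFrobenioid π hF) ψ
          (BiratUnits.unitsToBirat (pf_isFrobenioid π hF) X
            (unitsPerfEquivNat X (Perfection.of _ (D0.unitPull (π.map (Base (pfStr π hF) ψ)) w))))
          (BiratUnits.unitsToBirat (pf_isFrobenioid π hF) X' (unitsPerfEquivNat X' (Perfection.of _ w)))) :
    Thm36i_istrModel (pfStr π hF)
      (ModelFrobenioid.toElem (PreFrobenioid.Perfection.ops hF).monFunctor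
        (perfectionFunctor (fieldMonoid (Φ π) π)) (divPerfection (fieldMonoidToGp (Φ π) π))) :=
  istrModel_Q_of_sectionE π hF (fun X => unitsPerfEquivNat X) σ hσ hrad hunit

end Thm36Sub

end ArchFrd

end Literature.AlgebraicGeometry.Frobenioids

end
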